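import Summits.QuantumFields.YangMills.Theorems.UnitScaleTiltProp8IterTangent
import Summits.QuantumFields.YangMills.Theorems.UnitScaleTiltProp8EulerLagrangeCarrier
import HarnessLib

/-!
# Route `UnitScaleTilt`, crux K1 «MinimiserStabilityRegPr» (stmt-QuantumFields-19200), stub `stub_prop8` (V2) — sub-lemma V2-EL, part 7d:
# **THE k-FOLD EULER–LAGRANGE EQUATION IN MULTIPLIER FORM** (`exists_tangent_lin_eq_zero_iter`) and its carrier corollary for R2-critical configurations
# (`exists_tangent_lin_eq_zero_of_isCritR2_iter`)

Cell `ym3-torus` ∕ fleet seat `ym-ust-19200-p2` g4.  [Balaban1985Variational] Sect. F (p. 300: «We will use only the fact that they are critical configurations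
of the functional (5)») consumes the FULL criticality of `U_k` on the constraint manifold `𝔅_k(V) = {U : Ū^{(k)} = V}` of the k-FOLD average — in the chart
(47) the equation (133)/(158) with multipliers indexed by the bonds of the UNIT lattice.  Parts 5b ∕ 6 (g3, p508741 ∕ p510089) delivered the Euler–Lagrange
equation only along the tangent space of the TOP-STEP slice `{U : Ū = Ū₀}` (multipliers on the central bonds of the top step, `3·#bonds_{K−1}` of them); the
`(K−1)`-average of a k-fold minimiser minimises nothing, so the lower steps do not follow by nesting.  Here, from the k-fold tangent curves of part 7c: if `U₀`
minimises the `SU(2)` Wilson action over a set containing the germ at `U₀` of its k-fold fibre `{U : Ū^{(k)} = Ū₀^{(k)}}`, all iterated averages of `U₀` being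
`t₀`-small (`stokesConst·t₀ ≤ |I|⁻¹/1000`), then for every tower `T_i` of exceptional bond sets closed downwards under the central-bond maps with `T_k` = all
level-`k` bonds, every finest bond `b₀ ∉ T₀` and every differentiable `SU(2)`-curve `g` through `U₀(b₀)` with velocity `D₀`:
`∃ ξ, ξ(b₀) = D₀U₀(b₀)^* ∧ (ξ = 0 off {b₀} ∪ T₀) ∧ Lin_{U₀}(ξ) = 0`.  With the minimal tower `T_i = β^{k−i}({level-k bonds})` the multipliers live on the
`3·#bonds_k` iterated central bonds — the count of print's `λ` on `Λ_k` — and the `ξ`'s span the tangent space of the k-fold fibre.  §2: the same for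
`T3Thm1CarrierNative.IsCritR2` configurations of the d = 3 family (run `K`, comparison height `n`, `k = K − n`), directly from the definition of print's regular
fibre `(6)(e) = 𝔘_k(e) ∩ 𝔅_k(V)` (`descendTo = fieldShift ∘ iter (K − n)`) and the openness of `𝔘_k(e)` (part 6) — no nesting.  Sorry-free, no definition.
[folklore] ∕ cited.  References: T. Bałaban, CMP 102 (1985) 277–309 [Balaban1985Variational] ((5)–(6) p.278, (127) p.297, (133) p.298, p.300, Prop 8 p.304);
CMP 109 (1987) 249–301 [Balaban1987RG1] ((0.4), (0.11) p.253).
-/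

noncomputable section

open scoped BigOperators Matrix.Norms.L2Operator Matrix Topology
open Filter Function Asymptotics NormedSpace

namespace Summit.QuantumFields.YangMills.Theorems.Prop8Criticality

open Literature.MathematicalPhysics.QuantumFieldTheory.Balaban1983to89
open T4Continuum AveragingRT BlockAveraging BlockAveragingHaarAC BlockAveragingEMLHaarAC ExpMeanLog
open Summit.QuantumFields.YangMills.Theorems.BlockAvgCorrector (stokesConst stokesConst_nonneg emlWeight_pos emlWeight_le_one)

variable {P : Params}

/-! ## §1 The k-fold Euler–Lagrange equation in multiplier form (one tower) -/

section Tower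

/-- **THE k-FOLD EULER–LAGRANGE EQUATION IN MULTIPLIER FORM.**  Let all iterated (0.4)-averages `Ū₀^{(i)}`, `i < k`, of `U₀` be `t₀`-small with
`stokesConst·t₀ ≤ |I|⁻¹/1000` (`k ≤ m + K`), and let `U₀` minimise the `SU(2)` Wilson action over a set `S` containing the germ at `U₀` of its k-fold fibre
`{U : Ū^{(k)} = Ū₀^{(k)}}`.  Then for every tower `T_i ⊆ {level-i bonds}` closed downwards under the central-bond maps with `T_k` everything, every finest bond
`b₀ ∉ T₀` and every differentiable `SU(2)`-valued curve `g` through `U₀(b₀)` with velocity `D₀` there is a bond field `ξ` — the velocity of a curve INSIDE the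
k-fold fibre (part 7c) — with `ξ(b₀) = D₀U₀(b₀)^*`, `ξ = 0` at every other bond outside `T₀`, and `Lin_{U₀}(ξ) = 0`: the current at `b₀` is balanced by
currents on `T₀` alone (the multipliers). [cite: Balaban1985Variational, (127) p.297, (133) p.298; Balaban1987RG1, (0.11) p.253] -/
theorem exists_tangent_lin_eq_zero_iter (k : ℕ) (hk : k ≤ P.m + P.K) {t₀ : ℝ} (ht₀ : 0 < t₀)
    (hsmall : stokesConst P * t₀ ≤ emlWeight P / 1000)
    (U₀ : GaugeField P 0 (Matrix.specialUnitaryGroup (Fin 2) ℂ))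
    (hU₀ : ∀ i, i < k → PlaqSmall t₀ (Averaging.iter (fun i => blockAvg (P := P) (j := i) (expMeanLogSU (n := Fin 2))) i U₀))
    {S : Set (GaugeField P 0 (Matrix.specialUnitaryGroup (Fin 2) ℂ))}
    (hmin : IsMinOn (fun W : GaugeField P 0 (Matrix.specialUnitaryGroup (Fin 2) ℂ) => wilsonAction4 W) S U₀)
    (hS : ∃ δ : ℝ, 0 < δ ∧ ∀ U : GaugeField P 0 (Matrix.specialUnitaryGroup (Fin 2) ℂ),
      Averaging.iter (fun i => blockAvg (P := P) (j := i) (expMeanLogSU (n := Fin 2))) k U =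
        Averaging.iter (fun i => blockAvg (P := P) (j := i) (expMeanLogSU (n := Fin 2))) k U₀ →
        (∀ b, ‖(U b : Matrix (Fin 2) (Fin 2) ℂ) - (U₀ b : Matrix (Fin 2) (Fin 2) ℂ)‖ < δ) → U ∈ S)
    (T : (i : ℕ) → Set (PBond P i)) (hT : ∀ i, i < k → ∀ c : PBond P (i + 1), c ∈ T (i + 1) → centralBond c ∈ T i)
    (hTk : ∀ c : PBond P k, c ∈ T k)
    (b₀ : PBond P 0) (hb₀ : b₀ ∉ T 0)
    (g : ℝ → Matrix.specialUnitaryGroup (Fin 2) ℂ) (hg0 : g 0 = U₀ b₀) {D₀ : Matrix (Fin 2) (Fin 2) ℂ}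
    (hg : HasDerivAt (fun t : ℝ => (g t : Matrix (Fin 2) (Fin 2) ℂ)) D₀ 0) :
    ∃ ξ : PBond P 0 → Matrix (Fin 2) (Fin 2) ℂ,
      ξ b₀ = D₀ * star (U₀ b₀ : Matrix (Fin 2) (Fin 2) ℂ) ∧
      (∀ b : PBond P 0, b ≠ b₀ → b ∉ T 0 → ξ b = 0) ∧
      ∑ p : Plaq P 0, (1 / 2) * ((((((GaugeField.plaqHol U₀ p : Matrix.specialUnitaryGroup (Fin 2) ℂ) : Matrix (Fin 2) (Fin 2) ℂ)) - 1)ᴴ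
          * ((ξ ⟨p.src, p.μ⟩
              + (U₀ ⟨p.src, p.μ⟩ : Matrix (Fin 2) (Fin 2) ℂ) * ξ ⟨p.src.shift p.μ, p.ν⟩ * star (U₀ ⟨p.src, p.μ⟩ : Matrix (Fin 2) (Fin 2) ℂ)
              - ((U₀ ⟨p.src, p.μ⟩ * U₀ ⟨p.src.shift p.μ, p.ν⟩ * (U₀ ⟨p.src.shift p.ν, p.μ⟩)⁻¹ : Matrix.specialUnitaryGroup (Fin 2) ℂ) : Matrix (Fin 2) (Fin 2) ℂ)
                  * ξ ⟨p.src.shift p.ν, p.μ⟩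
                  * star ((U₀ ⟨p.src, p.μ⟩ * U₀ ⟨p.src.shift p.μ, p.ν⟩ * (U₀ ⟨p.src.shift p.ν, p.μ⟩)⁻¹ : Matrix.specialUnitaryGroup (Fin 2) ℂ) : Matrix (Fin 2) (Fin 2) ℂ)
              - ((GaugeField.plaqHol U₀ p : Matrix.specialUnitaryGroup (Fin 2) ℂ) : Matrix (Fin 2) (Fin 2) ℂ) * ξ ⟨p.src, p.ν⟩
                  * star ((GaugeField.plaqHol U₀ p : Matrix.specialUnitaryGroup (Fin 2) ℂ) : Matrix (Fin 2) (Fin 2) ℂ))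
            * ((GaugeField.plaqHol U₀ p : Matrix.specialUnitaryGroup (Fin 2) ℂ) : Matrix (Fin 2) (Fin 2) ℂ))).trace).re = 0 := by
  classical
  set Γ₀ : ℝ → GaugeField P 0 (Matrix.specialUnitaryGroup (Fin 2) ℂ) := fun t => update U₀ b₀ (g t) with hΓ₀
  have hΓ₀0 : Γ₀ 0 = U₀ := by simp only [hΓ₀, hg0, update_eq_self]
  have hΓ₀ne : ∀ t b, b ≠ b₀ → Γ₀ t b = U₀ b := fun t b hb => by simp only [hΓ₀, update_of_ne hb]
  have hΓ₀b₀ : ∀ t, Γ₀ t b₀ = g t := fun t => by simp only [hΓ₀, update_self]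
  have hΓ₀diff : ∀ b : PBond P 0, DifferentiableAt ℝ (fun t : ℝ => (Γ₀ t b : Matrix (Fin 2) (Fin 2) ℂ)) 0 := by
    intro b
    by_cases hb : b = b₀
    · subst hb; simp only [hΓ₀b₀]; exact hg.differentiableAt
    · simp only [hΓ₀ne _ b hb]; exact differentiableAt_const _
  have hsm : ∀ i, i < k → PlaqSmall t₀ (Averaging.iter (fun i => blockAvg (P := P) (j := i) (expMeanLogSU (n := Fin 2))) i (Γ₀ 0)) := by
    rw [hΓ₀0]; exact hU₀
  -- the tangent curve inside the k-fold fibre (part 7c, constant target)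
  obtain ⟨γ, hγ0, hγdiff, hγev, hγT⟩ := exists_iter_lift_curve (P := P) ht₀ hsmall k hk Γ₀ hΓ₀diff hsm T hT
    (fun _ => Averaging.iter (fun i => blockAvg (P := P) (j := i) (expMeanLogSU (n := Fin 2))) k U₀)
    (fun _ => differentiableAt_const _) (by rw [hΓ₀0]) (fun c hc => absurd (hTk c) hc)
  have hγ0' : γ 0 = U₀ := hγ0.trans hΓ₀0
  -- the curve stays in `S` near `t = 0`
  have hγS : ∀ᶠ t in 𝓝 (0 : ℝ), γ t ∈ S := by
    obtain ⟨δ, hδpos, hSδ⟩ := hS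
    have hnear : ∀ b : PBond P 0, ∀ᶠ t in 𝓝 (0 : ℝ), ‖((γ t b : Matrix.specialUnitaryGroup (Fin 2) ℂ) : Matrix (Fin 2) (Fin 2) ℂ) - (U₀ b : Matrix (Fin 2) (Fin 2) ℂ)‖ < δ := by
      intro b
      have h1 : Tendsto (fun t : ℝ => ((γ t b : Matrix.specialUnitaryGroup (Fin 2) ℂ) : Matrix (Fin 2) (Fin 2) ℂ)) (𝓝 0)
          (𝓝 ((U₀ b : Matrix.specialUnitaryGroup (Fin 2) ℂ) : Matrix (Fin 2) (Fin 2) ℂ)) := by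
        have := (hγdiff b).continuousAt.tendsto
        rwa [hγ0'] at this
      have h2 := h1 (Metric.ball_mem_nhds _ hδpos)
      filter_upwards [h2] with t ht
      rwa [Set.mem_preimage, Metric.mem_ball, dist_eq_norm] at ht
    filter_upwards [hγev, Filter.eventually_all.mpr hnear] with t ht hdist
    exact hSδ (γ t) ht hdist
  set ξ : PBond P 0 → Matrix (Fin 2) (Fin 2) ℂ := fun b =>
    deriv (fun t : ℝ => ((γ t b : Matrix.specialUnitaryGroup (Fin 2) ℂ) : Matrix (Fin 2) (Fin 2) ℂ) * star (U₀ b : Matrix (Fin 2) (Fin 2) ℂ)) 0 with hξ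
  have hξd : ∀ b, HasDerivAt (fun t : ℝ => ((γ t b : Matrix.specialUnitaryGroup (Fin 2) ℂ) : Matrix (Fin 2) (Fin 2) ℂ) * star (U₀ b : Matrix (Fin 2) (Fin 2) ℂ)) (ξ b) 0 :=
    fun b => ((hγdiff b).mul_const _).hasDerivAt
  have main := lin_eq_zero_of_isMinOn_of_hasDerivAt hmin γ hγS hγ0' ξ hξd
  refine ⟨ξ, ?_, ?_, main⟩
  · -- the velocity at `b₀`
    have h1 : HasDerivAt (fun t : ℝ => ((γ t b₀ : Matrix.specialUnitaryGroup (Fin 2) ℂ) : Matrix (Fin 2) (Fin 2) ℂ) * star (U₀ b₀ : Matrix (Fin 2) (Fin 2) ℂ))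
        (D₀ * star (U₀ b₀ : Matrix (Fin 2) (Fin 2) ℂ)) 0 := by
      refine (hg.mul_const (star (U₀ b₀ : Matrix (Fin 2) (Fin 2) ℂ))).congr_of_eventuallyEq ?_
      filter_upwards [hγT b₀ hb₀] with t ht
      rw [ht, hΓ₀b₀]
    exact (hξd b₀).unique h1
  · -- the velocity vanishes at the untouched bonds outside `T 0`
    intro b hb hbT
    have h1 : HasDerivAt (fun t : ℝ => ((γ t b : Matrix.specialUnitaryGroup (Fin 2) ℂ) : Matrix (Fin 2) (Fin 2) ℂ) * star (U₀ b : Matrix (Fin 2) (Fin 2) ℂ))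
        0 0 := by
      refine (hasDerivAt_const (0 : ℝ) (((U₀ b : Matrix.specialUnitaryGroup (Fin 2) ℂ) : Matrix (Fin 2) (Fin 2) ℂ) * star (U₀ b : Matrix (Fin 2) (Fin 2) ℂ))).congr_of_eventuallyEq ?_
      filter_upwards [hγT b hbT] with t ht
      rw [ht, hΓ₀ne t b hb]
    exact (hξd b).unique h1

end Tower

/-! ## §2 The k-fold Euler–Lagrange equation for R2-critical configurations of the d = 3 carrier -/

section Carrier

open T3ContinuumYM3Torus T3UnitLawDensityEML T3ConstrainedMinimiser T3TiltDescent T3DescentFibreTower T3LevelShift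
open T3PrintedRegularMinimiser T3RegularMinimiser T3Thm1CarrierNative
open BlockAveragingEMLHaarAC (emlWeight)

/-- **THE k-FOLD EULER–LAGRANGE EQUATION OF AN R2-CRITICAL CONFIGURATION AT THE d = 3 CARRIER, MULTIPLIER FORM.**  Let `U₀` be R2-critical over the datum `V`
(a minimiser of the Wilson action over print's regular fibre `(6)(e) = 𝔘_k(e) ∩ 𝔅_k(V)`, run `K`, comparison height `n ≤ K`, some `e > 0`), with all
iterated (0.4)-averages `Ū₀^{(i)}`, `i < K − n`, `t₀`-small, `stokesConst·t₀ ≤ |I|⁻¹/1000`.  Then for every tower `T_i` of exceptional bond sets of run `K`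
closed downwards under the central-bond maps with `T_{K−n}` everything, every finest bond `b₀ ∉ T₀` and every differentiable `SU(2)`-curve `g` through
`U₀(b₀)` with velocity `D₀`: `∃ ξ, ξ(b₀) = D₀U₀(b₀)^* ∧ (ξ = 0 off {b₀} ∪ T₀) ∧ Lin_{U₀}(ξ) = 0` — the criticality of [Balaban1985Variational] Sect. F for
the FULL k-fold constraint, multipliers on `T₀` (minimal choice: the iterated central bonds `β^{K−n}`(bonds of the `n`-th lattice)).
[cite: Balaban1985Variational, (127) p.297, (133) p.298, Prop 8 p.304; Balaban1987RG1, (0.11) p.253] -/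
theorem exists_tangent_lin_eq_zero_of_isCritR2_iter (F : T3Family) {n K : ℕ} (hnK : n ≤ K)
    {V : GaugeField (F.P n) 0 (Matrix.specialUnitaryGroup (Fin 2) ℂ)} {U₀ : GaugeField (F.P K) 0 (Matrix.specialUnitaryGroup (Fin 2) ℂ)}
    (hcrit : IsCritR2 F n K hnK V U₀)
    {t₀ : ℝ} (ht₀ : 0 < t₀) (hsmall : stokesConst (F.P K) * t₀ ≤ emlWeight (F.P K) / 1000)
    (hU₀ : ∀ i, i < K - n → PlaqSmall t₀ (Averaging.iter (fun i => blockAvg (P := F.P K) (j := i) (expMeanLogSU (n := Fin 2))) i U₀))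
    (T : (i : ℕ) → Set (PBond (F.P K) i)) (hT : ∀ i, i < K - n → ∀ c : PBond (F.P K) (i + 1), c ∈ T (i + 1) → centralBond c ∈ T i)
    (hTk : ∀ c : PBond (F.P K) (K - n), c ∈ T (K - n))
    (b₀ : PBond (F.P K) 0) (hb₀ : b₀ ∉ T 0)
    (g : ℝ → Matrix.specialUnitaryGroup (Fin 2) ℂ) (hg0 : g 0 = U₀ b₀) {D₀ : Matrix (Fin 2) (Fin 2) ℂ}
    (hg : HasDerivAt (fun t : ℝ => (g t : Matrix (Fin 2) (Fin 2) ℂ)) D₀ 0) :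
    ∃ ξ : PBond (F.P K) 0 → Matrix (Fin 2) (Fin 2) ℂ,
      ξ b₀ = D₀ * star (U₀ b₀ : Matrix (Fin 2) (Fin 2) ℂ) ∧
      (∀ b : PBond (F.P K) 0, b ≠ b₀ → b ∉ T 0 → ξ b = 0) ∧
      ∑ p : Plaq (F.P K) 0, (1 / 2) * ((((((GaugeField.plaqHol U₀ p : Matrix.specialUnitaryGroup (Fin 2) ℂ) : Matrix (Fin 2) (Fin 2) ℂ)) - 1)ᴴ
          * ((ξ ⟨p.src, p.μ⟩
              + (U₀ ⟨p.src, p.μ⟩ : Matrix (Fin 2) (Fin 2) ℂ) * ξ ⟨p.src.shift p.μ, p.ν⟩ * star (U₀ ⟨p.src, p.μ⟩ : Matrix (Fin 2) (Fin 2) ℂ)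
              - ((U₀ ⟨p.src, p.μ⟩ * U₀ ⟨p.src.shift p.μ, p.ν⟩ * (U₀ ⟨p.src.shift p.ν, p.μ⟩)⁻¹ : Matrix.specialUnitaryGroup (Fin 2) ℂ) : Matrix (Fin 2) (Fin 2) ℂ)
                  * ξ ⟨p.src.shift p.ν, p.μ⟩
                  * star ((U₀ ⟨p.src, p.μ⟩ * U₀ ⟨p.src.shift p.μ, p.ν⟩ * (U₀ ⟨p.src.shift p.ν, p.μ⟩)⁻¹ : Matrix.specialUnitaryGroup (Fin 2) ℂ) : Matrix (Fin 2) (Fin 2) ℂ)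
              - ((GaugeField.plaqHol U₀ p : Matrix.specialUnitaryGroup (Fin 2) ℂ) : Matrix (Fin 2) (Fin 2) ℂ) * ξ ⟨p.src, p.ν⟩
                  * star ((GaugeField.plaqHol U₀ p : Matrix.specialUnitaryGroup (Fin 2) ℂ) : Matrix (Fin 2) (Fin 2) ℂ))
            * ((GaugeField.plaqHol U₀ p : Matrix.specialUnitaryGroup (Fin 2) ℂ) : Matrix (Fin 2) (Fin 2) ℂ))).trace).re = 0 := by
  classical
  obtain ⟨e, -, hreg, hmin⟩ := hcrit
  have hU₀fib : U₀ ∈ fibre F ℰp n K hnK V := ((mem_regFibrePr_iff (F := F)).mp hreg).1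
  have hU₀reg : RegPr F n K e U₀ := ((mem_regFibrePr_iff (F := F)).mp hreg).2
  -- `𝔘_k(e)` is open in the bonds
  obtain ⟨δ, hδ, hball⟩ := exists_ball_subset_regPr F n K e U₀ hU₀reg
  have hk : K - n ≤ (F.P K).m + (F.P K).K := by
    show K - n ≤ F.m + K; omega
  refine exists_tangent_lin_eq_zero_iter (P := F.P K) (K - n) hk ht₀ hsmall U₀ hU₀ hmin ⟨δ, hδ, fun U hiter hdist => ?_⟩ T hT hTk b₀ hb₀ g hg0 hg
  -- a configuration with the same `(K − n)`-fold average lies in the same descent fibre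
  refine (mem_regFibrePr_iff (F := F)).mpr ⟨?_, hball U hdist⟩
  rw [mem_fibre_iff] at hU₀fib ⊢
  rw [← hU₀fib]
  exact congrArg (fun W => fieldShift _ W) hiter

end Carrier

end Summit.QuantumFields.YangMills.Theorems.Prop8Criticality

end
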